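import Mathlib
import HarnessLib
import Literature.Geometry.DiscreteGeometry.KissingRigidity

/-!
# Soft four-rings, endgame: labelled neighbour tables realise `fccAdj` / `hcpAdj`

Support file for `SoftFourRings` (route `PricedLinkCensus`, sub-problem `Crystallization`),
endgame step (E4)/(E5) of the evidence file (§12.8): if twelve injectively labelled points
`p 0, …, p 11` have bond neighbourhoods given by the FCC (resp. HCP) table of
`Literature/…/KissingRigidity` (`fccTab`, `hcpTab`), then `{p i, p j} ∈ B ↔ fccAdj i j`
(resp. `hcpAdj i j`) — a finite check.
-/

namespace Summit.AtomisticToContinuum.Crystallization.Theorems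

open Literature.Geometry.DiscreteGeometry

/-- **The FCC labelling**: twelve injectively labelled points whose bonds follow the fcc
neighbour table realise exactly `fccAdj`. -/
theorem labelling_fcc {B : Finset (Finset (EuclideanSpace ℝ (Fin 3)))} (p : Fin 12 → EuclideanSpace ℝ (Fin 3))
    (hinj : Function.Injective p)
    (h0 : ∀ y, ({p 0, y} : Finset (EuclideanSpace ℝ (Fin 3))) ∈ B ↔ (y = p 4 ∨ y = p 5 ∨ y = p 8 ∨ y = p 9))
    (h1 : ∀ y, ({p 1, y} : Finset (EuclideanSpace ℝ (Fin 3))) ∈ B ↔ (y = p 4 ∨ y = p 5 ∨ y = p 10 ∨ y = p 11))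
    (h2 : ∀ y, ({p 2, y} : Finset (EuclideanSpace ℝ (Fin 3))) ∈ B ↔ (y = p 6 ∨ y = p 7 ∨ y = p 8 ∨ y = p 9))
    (h3 : ∀ y, ({p 3, y} : Finset (EuclideanSpace ℝ (Fin 3))) ∈ B ↔ (y = p 6 ∨ y = p 7 ∨ y = p 10 ∨ y = p 11))
    (h4 : ∀ y, ({p 4, y} : Finset (EuclideanSpace ℝ (Fin 3))) ∈ B ↔ (y = p 0 ∨ y = p 1 ∨ y = p 8 ∨ y = p 10))
    (h5 : ∀ y, ({p 5, y} : Finset (EuclideanSpace ℝ (Fin 3))) ∈ B ↔ (y = p 0 ∨ y = p 1 ∨ y = p 9 ∨ y = p 11))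
    (h6 : ∀ y, ({p 6, y} : Finset (EuclideanSpace ℝ (Fin 3))) ∈ B ↔ (y = p 2 ∨ y = p 3 ∨ y = p 8 ∨ y = p 10))
    (h7 : ∀ y, ({p 7, y} : Finset (EuclideanSpace ℝ (Fin 3))) ∈ B ↔ (y = p 2 ∨ y = p 3 ∨ y = p 9 ∨ y = p 11))
    (h8 : ∀ y, ({p 8, y} : Finset (EuclideanSpace ℝ (Fin 3))) ∈ B ↔ (y = p 0 ∨ y = p 2 ∨ y = p 4 ∨ y = p 6))
    (h9 : ∀ y, ({p 9, y} : Finset (EuclideanSpace ℝ (Fin 3))) ∈ B ↔ (y = p 0 ∨ y = p 2 ∨ y = p 5 ∨ y = p 7))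
    (h10 : ∀ y, ({p 10, y} : Finset (EuclideanSpace ℝ (Fin 3))) ∈ B ↔ (y = p 1 ∨ y = p 3 ∨ y = p 4 ∨ y = p 6))
    (h11 : ∀ y, ({p 11, y} : Finset (EuclideanSpace ℝ (Fin 3))) ∈ B ↔ (y = p 1 ∨ y = p 3 ∨ y = p 5 ∨ y = p 7)) :
    ∀ i j : Fin 12, ({p i, p j} : Finset (EuclideanSpace ℝ (Fin 3))) ∈ B ↔ fccAdj i j := by
  intro i j
  fin_cases i <;> fin_cases j
  all_goals simp only [Fin.zero_eta, Fin.mk_one, Fin.isValue, Fin.reduceFinMk]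
  all_goals first | (rw [h0]) | (rw [h1]) | (rw [h2]) | (rw [h3]) | (rw [h4]) | (rw [h5]) | (rw [h6]) | (rw [h7]) | (rw [h8]) | (rw [h9]) | (rw [h10]) | (rw [h11])
  all_goals simp only [hinj.eq_iff, Fin.isValue]
  all_goals decide

/-- **The HCP labelling**: twelve injectively labelled points whose bonds follow the hcp
neighbour table realise exactly `hcpAdj`. -/
theorem labelling_hcp {B : Finset (Finset (EuclideanSpace ℝ (Fin 3)))} (p : Fin 12 → EuclideanSpace ℝ (Fin 3))
    (hinj : Function.Injective p)
    (h0 : ∀ y, ({p 0, y} : Finset (EuclideanSpace ℝ (Fin 3))) ∈ B ↔ (y = p 2 ∨ y = p 5 ∨ y = p 7 ∨ y = p 10))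
    (h1 : ∀ y, ({p 1, y} : Finset (EuclideanSpace ℝ (Fin 3))) ∈ B ↔ (y = p 3 ∨ y = p 4 ∨ y = p 8 ∨ y = p 11))
    (h2 : ∀ y, ({p 2, y} : Finset (EuclideanSpace ℝ (Fin 3))) ∈ B ↔ (y = p 0 ∨ y = p 4 ∨ y = p 6 ∨ y = p 9))
    (h3 : ∀ y, ({p 3, y} : Finset (EuclideanSpace ℝ (Fin 3))) ∈ B ↔ (y = p 1 ∨ y = p 5 ∨ y = p 8 ∨ y = p 11))
    (h4 : ∀ y, ({p 4, y} : Finset (EuclideanSpace ℝ (Fin 3))) ∈ B ↔ (y = p 1 ∨ y = p 2 ∨ y = p 6 ∨ y = p 9))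
    (h5 : ∀ y, ({p 5, y} : Finset (EuclideanSpace ℝ (Fin 3))) ∈ B ↔ (y = p 0 ∨ y = p 3 ∨ y = p 7 ∨ y = p 10))
    (h6 : ∀ y, ({p 6, y} : Finset (EuclideanSpace ℝ (Fin 3))) ∈ B ↔ (y = p 2 ∨ y = p 4 ∨ y = p 7 ∨ y = p 8))
    (h7 : ∀ y, ({p 7, y} : Finset (EuclideanSpace ℝ (Fin 3))) ∈ B ↔ (y = p 0 ∨ y = p 5 ∨ y = p 6 ∨ y = p 8))
    (h8 : ∀ y, ({p 8, y} : Finset (EuclideanSpace ℝ (Fin 3))) ∈ B ↔ (y = p 1 ∨ y = p 3 ∨ y = p 6 ∨ y = p 7))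
    (h9 : ∀ y, ({p 9, y} : Finset (EuclideanSpace ℝ (Fin 3))) ∈ B ↔ (y = p 2 ∨ y = p 4 ∨ y = p 10 ∨ y = p 11))
    (h10 : ∀ y, ({p 10, y} : Finset (EuclideanSpace ℝ (Fin 3))) ∈ B ↔ (y = p 0 ∨ y = p 5 ∨ y = p 9 ∨ y = p 11))
    (h11 : ∀ y, ({p 11, y} : Finset (EuclideanSpace ℝ (Fin 3))) ∈ B ↔ (y = p 1 ∨ y = p 3 ∨ y = p 9 ∨ y = p 10)) :
    ∀ i j : Fin 12, ({p i, p j} : Finset (EuclideanSpace ℝ (Fin 3))) ∈ B ↔ hcpAdj i j := by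
  intro i j
  fin_cases i <;> fin_cases j
  all_goals simp only [Fin.zero_eta, Fin.mk_one, Fin.isValue, Fin.reduceFinMk]
  all_goals first | (rw [h0]) | (rw [h1]) | (rw [h2]) | (rw [h3]) | (rw [h4]) | (rw [h5]) | (rw [h6]) | (rw [h7]) | (rw [h8]) | (rw [h9]) | (rw [h10]) | (rw [h11])
  all_goals simp only [hinj.eq_iff, Fin.isValue]
  all_goals decide

end Summit.AtomisticToContinuum.Crystallization.Theorems
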